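import Literature.AlgebraicGeometry.HodgeTheory.GlZariskiClosureGroup
import HarnessLib

/-!
# Functoriality of `Δ^Zar(K)` and of its identity component under maps that are polynomial in the
# entries and `1/det` (Borel, AG I.2.1 (c): `φ(Ā) ⊆ φ(A)⁻` for morphisms) — on `K`-points

Family `hodge`, layer `Literature/AlgebraicGeometry/HodgeTheory`. THEOREMS only. Sequel of
`GlZariskiClosureGroup` (`evalAtInvDet`: evaluation of `K[x_{ij}][y]` at `(M, 1/det M)` and the
clearing-of-denominators lemma `evalAtInvDet_eq_zero_of_mem`), for crux K1 of
`Summits/HodgeConjecture/HodgeConjecture/Theses/CyclicUnitaryPowers.lean` (lane D glue, step (g): carrying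
the Goursat–Kolchin–Ribet conclusion from `GL(⊕_j E_j)` back to `GL(V ⊗ ℂ)` along the block "section", whose
entries are polynomials in the blocks and their inverses).

* `eval_eq_zero_of_mem_of_evalAtInvDet` — if a polynomial relation among finitely many rational functions
  `E_k ∈ K[x_{ij}][1/det]` holds on `S ⊆ GL`, it holds on the entry-closure of `S`.
* `map_mem_glZariskiClosure_of_evalAtInvDet` — for ANY map `Φ : GL(V) → GL(W)` whose matrix entries (in fixed
  bases) are such rational functions of the matrix of the argument, and subgroups `Λ ≤ GL(V)`, `Θ ≤ GL(W)`
  with `Φ(Λ) ⊆ Θ`: `Φ(Λ^Zar(K)) ⊆ Θ^Zar(K)`.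
* `finiteIndex_map_subgroupOf` — images of finite-index pairs under a homomorphism have finite index.
* `map_mem_glIdentityComponent_of_evalAtInvDet` — if moreover `Φ` is a left inverse of a homomorphism
  `ψ : Θ → GL(W)` (`Φ (ψ θ) = θ`), then `Φ` carries `glIdentityComponent (range ψ)` into `glIdentityComponent Θ`.
Written by the prover seat `hodge-nonav-prover-Ax`.

## References
* [Borel1991] A. Borel, *Linear Algebraic Groups*, 2nd ed., GTM 126, Springer 1991, AG §I.1.7 (`GL_n = D(det)`,
  coordinate ring `K[x_{ij}, 1/det]`), I.2.1 (b),(c) (closures of subgroups; `φ(H)⁻` for morphisms `φ`),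
  I.2.4.
* [CarlsonMullerStachPeters2017] J. Carlson, S. Müller-Stach, C. Peters, *Period Mappings and Period Domains*,
  2nd ed., Lemma–Definition 15.3.7 (`Γ^Zar` and its identity component `Mon`).
-/

noncomputable section

open Module

namespace Literature.AlgebraicGeometry.HodgeTheory

/-! ### §1 Pull-back of polynomial relations along rational maps, endomorphism level -/

section EndLevel

universe u v

variable {K : Type u} [Field K] {V : Type v} [AddCommGroup V] [Module K V]
variable {ι : Type*} [Fintype ι] [DecidableEq ι]

/-- **Pull-back of closure membership along a family of rational functions** `E_k ∈ K[x_{ij}][1/det]`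
(a morphism `GL_n → 𝔸^σ`): if `P(E(s)) = 0` for all `s ∈ S` then `P(E(f)) = 0` for every `f` in the
entry-closure of `S` (all determinants non-zero). [cite: Borel1991, I.2.1 and I.1.7] -/
theorem eval_eq_zero_of_mem_of_evalAtInvDet (b : Module.Basis ι K V) {S : Set (Module.End K V)}
    {f : Module.End K V} (hf : f ∈ Literature.AlgebraicGeometry.Motives.zariskiClosureEndOfBasis b S)
    (hfdet : (LinearMap.toMatrix b b f).det ≠ 0) (hSdet : ∀ s ∈ S, (LinearMap.toMatrix b b s).det ≠ 0)
    {σ : Type*} (E : σ → Polynomial (MvPolynomial (ι × ι) K)) (P : MvPolynomial σ K)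
    (hP : ∀ s ∈ S, MvPolynomial.eval (fun k => evalAtInvDet (LinearMap.toMatrix b b s) (E k)) P = 0) :
    MvPolynomial.eval (fun k => evalAtInvDet (LinearMap.toMatrix b b f) (E k)) P = 0 := by
  have h := evalAtInvDet_eq_zero_of_mem b hf hfdet hSdet (MvPolynomial.aeval E P) (fun s hs => by
    rw [evalAtInvDet_aeval]; exact hP s hs)
  rwa [evalAtInvDet_aeval] at h

end EndLevel

/-! ### §2 `Φ(Λ^Zar) ⊆ Θ^Zar` for rational maps `Φ` with `Φ(Λ) ⊆ Θ` -/

section GLLevel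

universe u v w

variable {K : Type u} [Field K] {V : Type v} [AddCommGroup V] [Module K V] [Module.Finite K V]
  {W : Type w} [AddCommGroup W] [Module K W] [Module.Finite K W]
variable {ι : Type*} [Fintype ι] [DecidableEq ι] {κ : Type*} [Fintype κ] [DecidableEq κ]

omit [Module.Finite K V] in
/-- The matrix of an automorphism has non-zero determinant. [folklore] [cite: Borel1991, I.1.7] -/
private theorem det_toMatrix_coe_ne_zero (b : Module.Basis ι K V) (g : V ≃ₗ[K] V) :
    (LinearMap.toMatrix b b (g : Module.End K V)).det ≠ 0 := by
  have h : LinearMap.toMatrix b b ((g⁻¹ : V ≃ₗ[K] V) : Module.End K V) *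
      LinearMap.toMatrix b b (g : Module.End K V) = 1 := by
    rw [← LinearMap.toMatrix_mul, ← LinearEquiv.coe_toLinearMap_mul, inv_mul_cancel, LinearEquiv.coe_toLinearMap_one,
      LinearMap.toMatrix_id]
  exact (Matrix.isUnit_det_of_left_inverse h).ne_zero

/-- **Functoriality of the Zariski closure on points** (Borel I.2.1 (c): "`φ(Ā) ⊆ φ(A)⁻`" for a morphism
`φ`): let `Φ : GL(V) → GL(W)` be ANY map whose matrix entries in bases `c`/`b` are rational functions
`E_{kl} ∈ K[x_{ij}][1/det]` of the matrix of the argument, and `Λ ≤ GL(V)`, `Θ ≤ GL(W)` subgroups with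
`Φ(Λ) ⊆ Θ`.  Then `Φ(Λ^Zar(K)) ⊆ Θ^Zar(K)`. [cite: Borel1991, I.2.1] [cite: CarlsonMullerStachPeters2017, Lemma–Definition 15.3.7] -/
theorem map_mem_glZariskiClosure_of_evalAtInvDet (b : Module.Basis ι K V) (c : Module.Basis κ K W)
    (Φ : (V ≃ₗ[K] V) → (W ≃ₗ[K] W)) (E : κ × κ → Polynomial (MvPolynomial (ι × ι) K))
    (hΦ : ∀ g : V ≃ₗ[K] V, ∀ kl : κ × κ, LinearMap.toMatrix c c (Φ g : Module.End K W) kl.1 kl.2 =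
      evalAtInvDet (LinearMap.toMatrix b b (g : Module.End K V)) (E kl))
    {Λ : Subgroup (V ≃ₗ[K] V)} {Θ : Subgroup (W ≃ₗ[K] W)} (hΛΘ : ∀ g ∈ Λ, Φ g ∈ Θ)
    {g : V ≃ₗ[K] V} (hg : g ∈ glZariskiClosure Λ) : Φ g ∈ glZariskiClosure Θ := by
  classical
  rw [mem_glZariskiClosure_iff, ← Literature.AlgebraicGeometry.Motives.zariskiClosureEnd_basis_indep b] at hg
  rw [mem_glZariskiClosure_iff, ← Literature.AlgebraicGeometry.Motives.zariskiClosureEnd_basis_indep c]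
  intro P hP
  have hSdet : ∀ s ∈ (fun h : V ≃ₗ[K] V => (h : Module.End K V)) '' (Λ : Set (V ≃ₗ[K] V)),
      (LinearMap.toMatrix b b s).det ≠ 0 := by
    rintro _ ⟨δ, _, rfl⟩
    exact det_toMatrix_coe_ne_zero b δ
  have hev : ∀ x : V ≃ₗ[K] V,
      MvPolynomial.eval (fun kl => evalAtInvDet (LinearMap.toMatrix b b (x : Module.End K V)) (E kl)) P =
      MvPolynomial.eval (fun kl : κ × κ => LinearMap.toMatrix c c (Φ x : Module.End K W) kl.1 kl.2) P := by
    intro x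
    exact congrArg (fun v => MvPolynomial.eval v P) (funext fun kl => (hΦ x kl).symm)
  have h := eval_eq_zero_of_mem_of_evalAtInvDet b hg (det_toMatrix_coe_ne_zero b g) hSdet E P (by
    rintro _ ⟨δ, hδ, rfl⟩
    rw [hev]
    exact hP _ ⟨Φ δ, hΛΘ δ hδ, rfl⟩)
  rwa [hev] at h

end GLLevel

/-! ### §3 The identity component -/

section IdentityComponent

universe u v w

/-- **Homomorphic images of finite-index pairs have finite index**: for `ψ : G →* G'` and `Δ' ≤ Δ ≤ G` with
`[Δ : Δ'] < ∞`, the image `ψ(Δ')` has finite index in `ψ(Δ)`. [cite: CarlsonMullerStachPeters2017, proof of Proposition 15.3.9] -/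
theorem finiteIndex_map_subgroupOf {G G' : Type*} [Group G] [Group G'] (ψ : G →* G') {Δ Δ' : Subgroup G}
    (hfi : (Δ'.subgroupOf Δ).FiniteIndex) : ((Δ'.map ψ).subgroupOf (Δ.map ψ)).FiniteIndex := by
  let φ : Δ →* (Δ.map ψ) := (ψ.restrict Δ).codRestrict _ fun x => Subgroup.mem_map_of_mem _ x.2
  have hφ : Function.Surjective φ := by
    rintro ⟨_, hy⟩
    obtain ⟨δ, hδ, rfl⟩ := Subgroup.mem_map.1 hy
    exact ⟨⟨δ, hδ⟩, rfl⟩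
  have hcomap : (Δ'.subgroupOf Δ) ≤ ((Δ'.map ψ).subgroupOf (Δ.map ψ)).comap φ := by
    intro x hx
    rw [Subgroup.mem_comap, Subgroup.mem_subgroupOf]
    exact Subgroup.mem_map_of_mem _ (Subgroup.mem_subgroupOf.1 hx)
  haveI : (((Δ'.map ψ).subgroupOf (Δ.map ψ)).comap φ).FiniteIndex := Subgroup.finiteIndex_of_le hcomap
  refine ⟨?_⟩
  rw [← Subgroup.index_comap_of_surjective (H := (Δ'.map ψ).subgroupOf (Δ.map ψ)) hφ]
  exact this.index_ne_zero

variable {K : Type u} [Field K] {V : Type v} [AddCommGroup V] [Module K V] [Module.Finite K V]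
  {W : Type w} [AddCommGroup W] [Module K W] [Module.Finite K W]
variable {ι : Type*} [Fintype ι] [DecidableEq ι] {κ : Type*} [Fintype κ] [DecidableEq κ]

/-- **Functoriality of the identity component along a rational left inverse.**  Let `Θ ≤ GL(W)`,
`ψ : Θ →* GL(V)` a homomorphism and `Φ : GL(V) → GL(W)` a map with rational entries (as in
`map_mem_glZariskiClosure_of_evalAtInvDet`) such that `Φ (ψ θ) = θ` on `Θ`.  Then `Φ` carries
`glIdentityComponent (ψ Θ)` into `glIdentityComponent Θ`: a finite-index `Θ' ≤ Θ` has image `ψ(Θ')` of finite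
index in `ψ(Θ)`, and `Φ(ψ(Θ')) ⊆ Θ'`. (Used with `Θ = Γ ⊗ ℂ`, `ψ` = restriction to `⊕_j E_j`, `Φ` = the block
section.) [cite: Borel1991, I.2.1] [cite: CarlsonMullerStachPeters2017, Lemma–Definition 15.3.7] -/
theorem map_mem_glIdentityComponent_of_evalAtInvDet (b : Module.Basis ι K V) (c : Module.Basis κ K W)
    (Φ : (V ≃ₗ[K] V) → (W ≃ₗ[K] W)) (E : κ × κ → Polynomial (MvPolynomial (ι × ι) K))
    (hΦ : ∀ g : V ≃ₗ[K] V, ∀ kl : κ × κ, LinearMap.toMatrix c c (Φ g : Module.End K W) kl.1 kl.2 =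
      evalAtInvDet (LinearMap.toMatrix b b (g : Module.End K V)) (E kl))
    (Θ : Subgroup (W ≃ₗ[K] W)) (ψ : Θ →* (V ≃ₗ[K] V)) (hsec : ∀ θ : Θ, Φ (ψ θ) = (θ : W ≃ₗ[K] W))
    {g : V ≃ₗ[K] V} (hg : g ∈ glIdentityComponent ((⊤ : Subgroup Θ).map ψ)) :
    Φ g ∈ glIdentityComponent Θ := by
  rw [mem_glIdentityComponent_iff] at hg ⊢
  intro Θ' hle hfi
  -- `Λ' := ψ(Θ' ∩ Θ)` has finite index in `ψ(Θ)` and `Φ(Λ') ⊆ Θ'`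
  have hfi' : (((Θ'.subgroupOf Θ).map ψ).subgroupOf ((⊤ : Subgroup Θ).map ψ)).FiniteIndex := by
    refine finiteIndex_map_subgroupOf ψ ?_
    -- `(Θ'.subgroupOf Θ).subgroupOf ⊤` has the same index as `Θ'.subgroupOf Θ`
    refine ⟨?_⟩
    rw [Subgroup.subgroupOf, Subgroup.index_comap_of_surjective _ (Subgroup.topEquiv (G := Θ)).surjective]
    exact hfi.index_ne_zero
  have hx := hg _ (Subgroup.map_mono le_top) hfi'
  refine map_mem_glZariskiClosure_of_evalAtInvDet b c Φ E hΦ ?_ hx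
  rintro _ ⟨θ, hθ, rfl⟩
  rw [hsec]
  exact Subgroup.mem_subgroupOf.1 hθ

end IdentityComponent

/-! ### §4 Pointwise versions: the rational formula need only hold on `Λ` and at the point

For the block SECTION of the lane-D glue the matrix formula `E` is only meaningful on block-diagonal arguments;
the pull-back argument uses the formula exactly on `Λ` and at the one point of interest, so we record these
pointwise forms (same proofs). -/

section Pointwise

universe u v w

variable {K : Type u} [Field K] {V : Type v} [AddCommGroup V] [Module K V] [Module.Finite K V]
  {W : Type w} [AddCommGroup W] [Module K W] [Module.Finite K W]
variable {ι : Type*} [Fintype ι] [DecidableEq ι] {κ : Type*} [Fintype κ] [DecidableEq κ]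

omit [Module.Finite K V] in
/-- The matrix of an automorphism has non-zero determinant. [folklore] [cite: Borel1991, I.1.7] -/
private theorem det_toMatrix_coe_ne_zero' (b : Module.Basis ι K V) (g : V ≃ₗ[K] V) :
    (LinearMap.toMatrix b b (g : Module.End K V)).det ≠ 0 := by
  have h : LinearMap.toMatrix b b ((g⁻¹ : V ≃ₗ[K] V) : Module.End K V) *
      LinearMap.toMatrix b b (g : Module.End K V) = 1 := by
    rw [← LinearMap.toMatrix_mul, ← LinearEquiv.coe_toLinearMap_mul, inv_mul_cancel, LinearEquiv.coe_toLinearMap_one,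
      LinearMap.toMatrix_id]
  exact (Matrix.isUnit_det_of_left_inverse h).ne_zero

/-- **Pointwise functoriality of the Zariski closure** (Borel I.2.1 (c) on points): let `E_{kl} ∈ K[x_{ij}][1/det]`
be rational functions; suppose every `λ ∈ Λ ≤ GL(V)` has a partner `θ ∈ Θ ≤ GL(W)` whose matrix is `E` evaluated
at the matrix of `λ`, and `w ∈ GL(W)` has matrix `E` evaluated at the matrix of some `g ∈ Λ^Zar(K)`.  Then
`w ∈ Θ^Zar(K)`.  (No map `GL(V) → GL(W)` is required off `Λ ∪ {g}`.)
[cite: Borel1991, I.2.1] [cite: CarlsonMullerStachPeters2017, Lemma–Definition 15.3.7] -/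
theorem mem_glZariskiClosure_of_evalAtInvDet_of_forall_exists (b : Module.Basis ι K V) (c : Module.Basis κ K W)
    (E : κ × κ → Polynomial (MvPolynomial (ι × ι) K)) {Λ : Subgroup (V ≃ₗ[K] V)} {Θ : Subgroup (W ≃ₗ[K] W)}
    (hΛΘ : ∀ l ∈ Λ, ∃ θ ∈ Θ, ∀ kl : κ × κ, LinearMap.toMatrix c c (θ : Module.End K W) kl.1 kl.2 =
      evalAtInvDet (LinearMap.toMatrix b b (l : Module.End K V)) (E kl))
    {g : V ≃ₗ[K] V} (hg : g ∈ glZariskiClosure Λ) {w : W ≃ₗ[K] W}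
    (hw : ∀ kl : κ × κ, LinearMap.toMatrix c c (w : Module.End K W) kl.1 kl.2 =
      evalAtInvDet (LinearMap.toMatrix b b (g : Module.End K V)) (E kl)) :
    w ∈ glZariskiClosure Θ := by
  classical
  rw [mem_glZariskiClosure_iff, ← Literature.AlgebraicGeometry.Motives.zariskiClosureEnd_basis_indep b] at hg
  rw [mem_glZariskiClosure_iff, ← Literature.AlgebraicGeometry.Motives.zariskiClosureEnd_basis_indep c]
  intro P hP
  have hSdet : ∀ s ∈ (fun h : V ≃ₗ[K] V => (h : Module.End K V)) '' (Λ : Set (V ≃ₗ[K] V)),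
      (LinearMap.toMatrix b b s).det ≠ 0 := by
    rintro _ ⟨δ, _, rfl⟩
    exact det_toMatrix_coe_ne_zero' b δ
  have hwP : MvPolynomial.eval (fun kl : κ × κ => LinearMap.toMatrix c c (w : Module.End K W) kl.1 kl.2) P =
      MvPolynomial.eval (fun kl => evalAtInvDet (LinearMap.toMatrix b b (g : Module.End K V)) (E kl)) P :=
    congrArg (fun v => MvPolynomial.eval v P) (funext fun kl => hw kl)
  rw [hwP]
  refine eval_eq_zero_of_mem_of_evalAtInvDet b hg (det_toMatrix_coe_ne_zero' b g) hSdet E P ?_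
  rintro _ ⟨l, hl, rfl⟩
  obtain ⟨θ, hθ, hθE⟩ := hΛΘ l hl
  have h := hP _ ⟨θ, hθ, rfl⟩
  rwa [show (fun kl : κ × κ => LinearMap.toMatrix c c (θ : Module.End K W) kl.1 kl.2) =
      fun kl => evalAtInvDet (LinearMap.toMatrix b b (l : Module.End K V)) (E kl) from funext fun kl => hθE kl] at h

/-- **Pointwise functoriality of the identity component.**  Let `Θ ≤ GL(W)`, `ψ : Θ →* GL(V)` a homomorphism,
and `E` rational functions such that the matrix of every `θ ∈ Θ` is `E` evaluated at the matrix of `ψ θ` (a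
rational left inverse of `ψ`, given only on `ψ(Θ)`).  If `g ∈ glIdentityComponent (ψ Θ)` and `w ∈ GL(W)` has matrix
`E` evaluated at the matrix of `g`, then `w ∈ glIdentityComponent Θ`. (Lane D: `Θ = Γ ⊗ ℂ`, `ψ` = block restriction,
`E` = the block section, `g` = the blocks of the commutator, `w` = the commutator.)
[cite: Borel1991, I.2.1] [cite: CarlsonMullerStachPeters2017, Lemma–Definition 15.3.7] -/
theorem mem_glIdentityComponent_of_evalAtInvDet_of_leftInverse (b : Module.Basis ι K V) (c : Module.Basis κ K W)
    (E : κ × κ → Polynomial (MvPolynomial (ι × ι) K)) (Θ : Subgroup (W ≃ₗ[K] W)) (ψ : Θ →* (V ≃ₗ[K] V))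
    (hsec : ∀ θ : Θ, ∀ kl : κ × κ, LinearMap.toMatrix c c ((θ : W ≃ₗ[K] W) : Module.End K W) kl.1 kl.2 =
      evalAtInvDet (LinearMap.toMatrix b b (ψ θ : Module.End K V)) (E kl))
    {g : V ≃ₗ[K] V} (hg : g ∈ glIdentityComponent ((⊤ : Subgroup Θ).map ψ)) {w : W ≃ₗ[K] W}
    (hw : ∀ kl : κ × κ, LinearMap.toMatrix c c (w : Module.End K W) kl.1 kl.2 =
      evalAtInvDet (LinearMap.toMatrix b b (g : Module.End K V)) (E kl)) :
    w ∈ glIdentityComponent Θ := by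
  rw [mem_glIdentityComponent_iff] at hg ⊢
  intro Θ' hle hfi
  have hfi' : (((Θ'.subgroupOf Θ).map ψ).subgroupOf ((⊤ : Subgroup Θ).map ψ)).FiniteIndex := by
    refine finiteIndex_map_subgroupOf ψ ?_
    refine ⟨?_⟩
    rw [Subgroup.subgroupOf, Subgroup.index_comap_of_surjective _ (Subgroup.topEquiv (G := Θ)).surjective]
    exact hfi.index_ne_zero
  have hx := hg _ (Subgroup.map_mono le_top) hfi'
  refine mem_glZariskiClosure_of_evalAtInvDet_of_forall_exists b c E ?_ hx hw
  rintro _ ⟨θ, hθ, rfl⟩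
  exact ⟨θ, Subgroup.mem_subgroupOf.1 hθ, hsec θ⟩

end Pointwise

end Literature.AlgebraicGeometry.HodgeTheory

end
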